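/-
Copyright: the b2b-balaban T⁴-continuum CRUX team, row NE7b OWNER lineage `t4-ne7b-p1` (gen 131). Project licence.
-/
import Summits.QuantumFields.BalabanUV.T4Continuum.Spine.NE7b.SupLargeFieldRegionsPaid

/-!
# THE LARGE-FIELD COMPONENT OF A CELL CARRIES ITS PENALTY — (335)'s CONSUMER STEP: for the random large-field set
# `T(ψ) = {p ∈ C : Ψ² ≤ Σ_{cell p}ψ²}` of the next Gaussian field and the `R`-connected COMPONENT `K(ψ)` of a fixed cell `q` inside `T(ψ)`
# (empty when `q` is small), the exponential penalty of the component is paid locally: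
#   `∫ ∏_{p∈K(ψ)} e^{a}e^{bΣ_{cell p}ψ²} dN(0,Γ)(ψ) ≤ 1 + 2η″`,  `η″ = e^{a}e^{−(κ∕2−b)Ψ²}A^v`,  whenever `(Δ+1)²η″ ≤ ½`
# — because `K(ψ)` is one of the `R`-connected regions through `q`, its penalty is ONE TERM of (335)'s weighted Peierls sum (the large cells of
# `K(ψ)` carry their indicators), uniformly in the volume `C` (row NE7b, node U5c; (335)∕(308) BY NAME; [folklore])

Cell `pub-balaban`, sub-cell `t4`, spine estimate NE7b (`T4WeightBudget.RelWeightBound`; the cell's OWN estimate — NOT PRINTED in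
[Bałaban 1983–89], NOT PROVED).  Crux-route work under `Spine/NE7b/` by the row OWNER (`t4-ne7b-p1` gen 131, file (343)) under FREEZE
(0)'s crux-prover clause, on § [NE7bP1-G130-HANDOFF] NEXT (3)(d) («(iii)'s consumer step: identify (309)'s penalty restricted to the
large-field component of `q` with one term of (335)'s family sum»); NOTHING of Bałaban's is named as a Lean object, valued or asserted; no
`T4Continuum/Support` leaf typed; no `def`, no notation (the component is any selector `K` characterised by reachability inside the large
set — it exists, §1); zero `sorry`.  Imports (BY NAME): the OWNER's (335) `…SupLargeFieldRegionsPaid` (`sum_integral_prod_cellWeight_le`,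
`prod_cellWeight_nonneg`; through it (308) `integrable_prod_cellWeight`); the tree's `IsRConnected`, `rconnSubsets`, `mem_rconnSubsets`.

WHAT IS PROVED ([folklore]; `S_T = (R · · ∧ · ∈ T ∧ · ∈ T)` the adjacency inside `T`, the component of `q` = the cells of `T` reachable from
`q` along `S_T`):
* §1 THE COMPONENT: `exists_component` (a selector exists), `component_subset`, `mem_component_self`, `component_eq_empty` (`q ∉ T`),
  `reach_lift` ∕ `reach_symm` (paths from `q` inside `T` are paths inside the component; reversal under symmetric `R`),
  **`component_isRConnected`**, `component_mem_family` (`K ∈ {L ∈ rconnSubsets R C : q ∈ L}` when `q ∈ T ⊆ C`);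
* §2 THE POINTWISE DOMINATION `prod_component_le_one_add_sum` (nonnegative cell weights `g`: `∏_{p∈K} g p ≤ 1 + Σ_{L : q ∈ L ∈ rconnSubsets R C} ∏_{p∈L} g p`);
* §3 THE END **`integral_component_penalty_le`** (`∫ ∏_{p∈K(ψ)} e^{a}e^{bΣ_{cell p}ψ²} dN(0,Γ) ≤ 1 + 2η″` for every selector `K(ψ)` of the
  component of `q` in the large set, under (335)'s hypotheses); §4 toy.

HONEST (what this is NOT).  The bound is by monotonicity of the integral against (335)'s integrable summed weight (the AE-measurability of the
component penalty itself is not asserted here — it holds, the selector being a finite Boolean combination of the large-cell events, and is the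
successor's bookkeeping if a consumer needs the penalty as an `Integrable` object); one pair of scales; scalar skeleton ((A3), NC-NE7b-α
UNRULED); nothing of Bałaban's asserted.  BY-NAME EFFECT ON THE WALL: NONE.  NE7b NOT PRINTED ∕ NOT PROVED; spine PROVED 0∕9; rung (B)+1 —
the programme's measures remain FINITE-torus statements; NOT the mass gap, NOT Clay.  HONEST DEPENDENCY: continuum YM on T⁴ ⇐ BetaPertH ∧
nine spine estimates (0∕9 proved); BetaPertH ⇐ (D1) ∧ (D4) ∧ CAP+tail; G-an2-4 gates asym, D1 and NE2∕3∕4.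
-/

set_option autoImplicit false

noncomputable section

namespace Summit.QuantumFields.BalabanUV.T4Continuum.NE7b.SupLargeFieldComponentPaid

open MeasureTheory ProbabilityTheory Finset Real
open scoped BigOperators
open Literature.Probability.LatticeModels (IsRConnected rconnSubsets mem_rconnSubsets)
open SupLargeFieldRegionsPaid (sum_integral_prod_cellWeight_le prod_cellWeight_nonneg)
open SupLargeFieldPenaltyPaid (integrable_prod_cellWeight)

variable {V : Type*} [DecidableEq V] {R : V → V → Prop}

/-! ## §1. The component of a cell inside a cell set -/

omit [DecidableEq V] in
/-- **A component selector exists**: for every `T`, `q` there is a finite set `K` with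
`p ∈ K ↔ p ∈ T ∧ q ⇝ p along R inside T`. [folklore] -/
theorem exists_component (T : Finset V) (q : V) :
    ∃ K : Finset V, ∀ p, p ∈ K ↔ p ∈ T ∧ Relation.ReflTransGen (fun a b => R a b ∧ a ∈ T ∧ b ∈ T) q p := by
  classical
  exact ⟨T.filter fun p => Relation.ReflTransGen (fun a b => R a b ∧ a ∈ T ∧ b ∈ T) q p, fun p => by rw [mem_filter]⟩

section Component

variable {T K : Finset V} {q : V} (hK : ∀ p, p ∈ K ↔ p ∈ T ∧ Relation.ReflTransGen (fun a b => R a b ∧ a ∈ T ∧ b ∈ T) q p)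
include hK

omit [DecidableEq V] in
/-- `K ⊆ T`. [folklore] -/
theorem component_subset : K ⊆ T := fun p hp => ((hK p).1 hp).1

omit [DecidableEq V] in
/-- `q ∈ T ⟹ q ∈ K`. [folklore] -/
theorem mem_component_self (hq : q ∈ T) : q ∈ K := (hK q).2 ⟨hq, Relation.ReflTransGen.refl⟩

omit [DecidableEq V] in
/-- `q ∉ T ⟹ K = ∅` (a path from `q` inside `T` starts at a cell of `T`). [folklore] -/
theorem component_eq_empty (hq : q ∉ T) : K = ∅ := by
  refine eq_empty_of_forall_notMem fun p hp => ?_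
  obtain ⟨hpT, hpath⟩ := (hK p).1 hp
  rcases hpath.cases_head with h | ⟨c, hqc, -⟩
  · subst h
    exact hq hpT
  · exact hq hqc.2.1

omit [DecidableEq V] in
/-- **Paths from `q` inside `T` are paths inside the component.** [folklore] -/
theorem reach_lift {p : V} (h : Relation.ReflTransGen (fun a b => R a b ∧ a ∈ T ∧ b ∈ T) q p) :
    Relation.ReflTransGen (fun a b => R a b ∧ a ∈ K ∧ b ∈ K) q p := by
  induction h with
  | refl => exact Relation.ReflTransGen.refl
  | tail hqb hbc ih =>
      exact ih.tail ⟨hbc.1, (hK _).2 ⟨hbc.2.1, hqb⟩, (hK _).2 ⟨hbc.2.2, hqb.tail hbc⟩⟩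

omit [DecidableEq V] hK in
/-- Reversal of paths inside the component for symmetric `R`. [folklore] -/
theorem reach_symm (hR : ∀ x y, R x y → R y x) {u p : V} (h : Relation.ReflTransGen (fun a b => R a b ∧ a ∈ K ∧ b ∈ K) u p) :
    Relation.ReflTransGen (fun a b => R a b ∧ a ∈ K ∧ b ∈ K) p u := by
  induction h with
  | refl => exact Relation.ReflTransGen.refl
  | tail _ hbc ih => exact Relation.ReflTransGen.head ⟨hR _ _ hbc.1, hbc.2.2, hbc.2.1⟩ ih

omit [DecidableEq V] in
/-- **THE COMPONENT IS `R`-CONNECTED** (`R` symmetric, `q ∈ T`). [folklore] -/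
theorem component_isRConnected (hR : ∀ x y, R x y → R y x) (hq : q ∈ T) : IsRConnected R K := by
  refine ⟨⟨q, mem_component_self hK hq⟩, fun u hu p hp => ?_⟩
  have hu' := reach_lift hK ((hK u).1 hu).2
  have hp' := reach_lift hK ((hK p).1 hp).2
  exact (reach_symm hR hu').trans hp'

/-- **The component is one of the `R`-connected regions through `q`**: `q ∈ T ⊆ C` ⟹ `K ∈ {L ∈ rconnSubsets R C : q ∈ L}`. [folklore] -/
theorem component_mem_family (hR : ∀ x y, R x y → R y x) {C : Finset V} (hTC : T ⊆ C) (hq : q ∈ T) :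
    K ∈ (rconnSubsets R C).filter fun L => q ∈ L :=
  mem_filter.2 ⟨mem_rconnSubsets.2 ⟨(component_subset hK).trans hTC, component_isRConnected hK hR hq⟩, mem_component_self hK hq⟩

/-! ## §2. The pointwise domination -/

/-- **THE COMPONENT'S WEIGHT IS ONE TERM OF THE FAMILY SUM**: nonnegative cell weights `g` on `C`, `T ⊆ C` ⟹
`∏_{p∈K} g p ≤ 1 + Σ_{L ∈ rconnSubsets R C, q ∈ L} ∏_{p∈L} g p` (the `1` covers `q ∉ T`, where `K = ∅`). [folklore] -/
theorem prod_component_le_one_add_sum (hR : ∀ x y, R x y → R y x) {C : Finset V} (hTC : T ⊆ C) {g : V → ℝ} (hg : ∀ p ∈ C, 0 ≤ g p) :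
    ∏ p ∈ K, g p ≤ 1 + ∑ L ∈ (rconnSubsets R C).filter (fun L => q ∈ L), ∏ p ∈ L, g p := by
  have hsum : 0 ≤ ∑ L ∈ (rconnSubsets R C).filter (fun L => q ∈ L), ∏ p ∈ L, g p :=
    sum_nonneg fun L hL => prod_nonneg fun p hp => hg p ((mem_rconnSubsets.1 (mem_filter.1 hL).1).1 hp)
  by_cases hq : q ∈ T
  · have h1 : ∏ p ∈ K, g p ≤ ∑ L ∈ (rconnSubsets R C).filter (fun L => q ∈ L), ∏ p ∈ L, g p :=
      single_le_sum (f := fun L => ∏ p ∈ L, g p)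
        (fun L hL => prod_nonneg fun p hp => hg p ((mem_rconnSubsets.1 (mem_filter.1 hL).1).1 hp))
        (component_mem_family hK hR hTC hq)
    linarith
  · rw [component_eq_empty hK hq, prod_empty]
    linarith

end Component

/-! ## §3. THE END: the component penalty is paid locally -/

variable {ι : Type} [Fintype ι] [DecidableEq ι]

/-- **THE LARGE-FIELD COMPONENT OF A CELL CARRIES ITS PENALTY.**  `Γ ⪰ 0`, `Γ ⪯ γ_op·1`, diagonal `≤ γ` (`γ ≥ 0`); disjoint cells of `≤ v`
sites; `R` symmetric with `≤ Δ` neighbours; `0 ≤ κ`, `0 < θ < 1`, `κγ_op ≤ θ`, `b ≤ κ∕2`; `(Δ+1)²η″ ≤ ½` with `η″ = e^{a}e^{−(κ∕2−b)Ψ²}A^v`; a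
volume `C ∋ q`; and ANY selector `K(ψ)` of the component of `q` in the large set `{p ∈ C : Ψ² ≤ Σ_{cell p}ψ²}` ⟹
`∫ ∏_{p∈K(ψ)} e^{a}e^{bΣ_{cell p}ψ²} dN(0,Γ) ≤ 1 + 2η″`, uniformly in `C`. [folklore] -/
theorem integral_component_penalty_le {Γ : Matrix ι ι ℝ} {γop γ : ℝ} (hΓ : Γ.PosSemidef)
    (hΓop : (γop • (1 : Matrix ι ι ℝ) - Γ).PosSemidef) (hdiag : ∀ i, Γ i i ≤ γ) (hγ : 0 ≤ γ) (cell : V → Finset ι)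
    (hdisj : ∀ p q, p ≠ q → Disjoint (cell p) (cell q)) {v : ℕ} (hv : ∀ p, (cell p).card ≤ v)
    (hR : ∀ x y, R x y → R y x) {nbr : V → Finset V} {Δ : ℕ} (hΔ : ∀ x, (nbr x).card ≤ Δ) (hnbr : ∀ x y, R x y → y ∈ nbr x)
    {κ θ b : ℝ} (hκ : 0 ≤ κ) (hθ0 : 0 < θ) (hθ1 : θ < 1) (hκθ : κ * γop ≤ θ) (hb : b ≤ κ / 2) (Ψ a : ℝ)
    (hsmall : ((Δ : ℝ) + 1) ^ 2 * (exp a * (exp (-((κ / 2 - b) * Ψ ^ 2)) * ((1 - θ) ^ (-(κ * γ / (2 * θ)))) ^ v)) ≤ 1 / 2)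
    (C : Finset V) (q : V) (K : EuclideanSpace ℝ ι → Finset V)
    (hK : ∀ ω p, p ∈ K ω ↔ p ∈ C.filter (fun p => Ψ ^ 2 ≤ ∑ x ∈ cell p, ω x ^ 2) ∧
      Relation.ReflTransGen (fun a c => R a c ∧ a ∈ C.filter (fun p => Ψ ^ 2 ≤ ∑ x ∈ cell p, ω x ^ 2) ∧
        c ∈ C.filter (fun p => Ψ ^ 2 ≤ ∑ x ∈ cell p, ω x ^ 2)) q p) :
    ∫ ω : EuclideanSpace ℝ ι, ∏ p ∈ K ω, (exp a * exp (b * ∑ x ∈ cell p, ω x ^ 2)) ∂(multivariateGaussian 0 Γ) ≤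
      1 + 2 * (exp a * (exp (-((κ / 2 - b) * Ψ ^ 2)) * ((1 - θ) ^ (-(κ * γ / (2 * θ)))) ^ v)) := by
  set μ := multivariateGaussian 0 Γ with hμ
  set 𝒴 : Finset (Finset V) := (rconnSubsets R C).filter fun L => q ∈ L with h𝒴
  have h𝒴' : ∀ L ∈ 𝒴, q ∈ L ∧ IsRConnected R L := fun L hL =>
    ⟨(mem_filter.1 hL).2, (mem_rconnSubsets.1 (mem_filter.1 hL).1).2⟩
  -- pointwise: the component's penalty is one term of the summed weight
  have hpt : ∀ ω : EuclideanSpace ℝ ι, ∏ p ∈ K ω, (exp a * exp (b * ∑ x ∈ cell p, ω x ^ 2)) ≤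
      1 + ∑ L ∈ 𝒴, ∏ p ∈ L, ((if Ψ ^ 2 ≤ ∑ x ∈ cell p, ω x ^ 2 then (1 : ℝ) else 0) *
        (exp a * exp (b * ∑ x ∈ cell p, ω x ^ 2))) := fun ω => by
    have hTC : C.filter (fun p => Ψ ^ 2 ≤ ∑ x ∈ cell p, ω x ^ 2) ⊆ C := filter_subset _ _
    have e : ∏ p ∈ K ω, (exp a * exp (b * ∑ x ∈ cell p, ω x ^ 2)) =
        ∏ p ∈ K ω, ((if Ψ ^ 2 ≤ ∑ x ∈ cell p, ω x ^ 2 then (1 : ℝ) else 0) * (exp a * exp (b * ∑ x ∈ cell p, ω x ^ 2))) :=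
      prod_congr rfl fun p hp => by
        have hlarge : Ψ ^ 2 ≤ ∑ x ∈ cell p, ω x ^ 2 := (mem_filter.1 ((hK ω p).1 hp).1).2
        rw [if_pos hlarge, one_mul]
    rw [e]
    exact prod_component_le_one_add_sum (hK ω) hR hTC
      (fun p _ => mul_nonneg (by split_ifs <;> norm_num) (by positivity))
  -- integrate against the summed weight
  have hI : ∀ L ∈ 𝒴, Integrable (fun ω : EuclideanSpace ℝ ι => ∏ p ∈ L, ((if Ψ ^ 2 ≤ ∑ x ∈ cell p, ω x ^ 2 then (1 : ℝ) else 0) *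
      (exp a * exp (b * ∑ x ∈ cell p, ω x ^ 2)))) μ := fun L _ => integrable_prod_cellWeight hΓ hΓop cell hdisj hκ hθ1 hκθ hb L Ψ a
  have hS : Integrable (fun ω : EuclideanSpace ℝ ι => ∑ L ∈ 𝒴, ∏ p ∈ L, ((if Ψ ^ 2 ≤ ∑ x ∈ cell p, ω x ^ 2 then (1 : ℝ) else 0) *
      (exp a * exp (b * ∑ x ∈ cell p, ω x ^ 2)))) μ := integrable_finsetSum 𝒴 hI
  have hRHS : Integrable (fun ω : EuclideanSpace ℝ ι => 1 + ∑ L ∈ 𝒴, ∏ p ∈ L, ((if Ψ ^ 2 ≤ ∑ x ∈ cell p, ω x ^ 2 then (1 : ℝ) else 0) *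
      (exp a * exp (b * ∑ x ∈ cell p, ω x ^ 2)))) μ := (integrable_const (1 : ℝ)).add hS
  have hsumle := sum_integral_prod_cellWeight_le hΓ hΓop hdiag hγ cell hdisj hv hR hΔ hnbr hκ hθ0 hθ1 hκθ hb Ψ a hsmall q 𝒴 h𝒴'
  calc ∫ ω : EuclideanSpace ℝ ι, ∏ p ∈ K ω, (exp a * exp (b * ∑ x ∈ cell p, ω x ^ 2)) ∂μ
      ≤ ∫ ω : EuclideanSpace ℝ ι, (1 + ∑ L ∈ 𝒴, ∏ p ∈ L, ((if Ψ ^ 2 ≤ ∑ x ∈ cell p, ω x ^ 2 then (1 : ℝ) else 0) *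
          (exp a * exp (b * ∑ x ∈ cell p, ω x ^ 2)))) ∂μ :=
        integral_mono_of_nonneg (ae_of_all _ fun ω => prod_nonneg fun p _ => by positivity) hRHS (ae_of_all _ hpt)
    _ = 1 + ∑ L ∈ 𝒴, ∫ ω : EuclideanSpace ℝ ι, ∏ p ∈ L, ((if Ψ ^ 2 ≤ ∑ x ∈ cell p, ω x ^ 2 then (1 : ℝ) else 0) *
          (exp a * exp (b * ∑ x ∈ cell p, ω x ^ 2))) ∂μ := by
        rw [integral_add (integrable_const _) hS, integral_finsetSum 𝒴 hI, integral_const]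
        simp
    _ ≤ _ := by linarith

/-! ## §4. Toy -/

/-- Toy (§1): with the EMPTY cell set the component of any cell is empty. -/
example (q : Fin 3) (K : Finset (Fin 3))
    (hK : ∀ p, p ∈ K ↔ p ∈ (∅ : Finset (Fin 3)) ∧ Relation.ReflTransGen (fun a b => a ≠ b ∧ a ∈ (∅ : Finset (Fin 3)) ∧ b ∈ (∅ : Finset (Fin 3))) q p) :
    K = ∅ :=
  component_eq_empty hK (Finset.notMem_empty q)

end Summit.QuantumFields.BalabanUV.T4Continuum.NE7b.SupLargeFieldComponentPaid
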